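import Summits.Schanuel.Schanuel.Theorems.SoloInformedX193EntryFare

/-!
# X193 kernel line, file F5b: the window of cheap levels and the lifetime payment

Solo seat `solo-Schanuel-informed`, X193 kernel programme (design note
`work/s213/X193-KERNEL-DESIGN.md`, Amendments A2/A3; pen proof `work/s194/X193-pen.md`
§5 (b')(1),(2) and Corollary (i)-(iii); files F2 = `SoloInformedX193Service`,
F5 = `SoloInformedX193EntryFare`).

For ONE piece `P` of an abstract service structure `D : SoloServiceData ι`, alive at a
level `n` with entry level `e = ℓ + 1`:

* `cost_ratio`: `n C_P(ℓ) ≤ ℓ C_P(n)` for `1 ≤ ℓ ≤ n`, `β ≥ 1`;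
* `window_upper` (pen §5 (b')(1)): a cheap server obeying the supply bound
  `|S| ℓ^ν ≤ T ≤ t C_P(ℓ)` has `m n ℓ^ν ≤ η t ℓ n^ν`, i.e. `ρ^{ν-1} ≤ η t / m` for
  `ρ = ℓ / n` (cheap levels start a bounded FACTOR after the entry);
* `window_lower` (pen §5 (b')(2)): with the cap bound `cap_n(P) ≤ U`,
  `λ n ℓ^ν ≤ η t ℓ U` (cheap levels end by `≍ ℓ^{2+β-ν} = ℓ / c_ℓ`);
* `payment_term`, `payment_lower` (pen §5 Cor (iii), counting form): on a window of levels
  `[e, V]` inside the life, `Σ_ℓ m_P(ℓ) C_P(ℓ) / ℓ^{β+2} ≥ (V+1-e) (g_P / V² + L_P / V^{β+1})`;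
* `soloX_window_payment`: `(V+1-e) (g / V² + L / V^{β+1}) ≥ (θ / κ^{β+1}) (g / e + L / e^β)`
  when `θ e ≤ V + 1 - e` and `V ≤ κ e` (so the payment is `≥ γ'' σ_P(e)`).

No definitions, no sorries.
-/

namespace Summit.Schanuel.Schanuel.Theorems

open Finset

namespace SoloServiceData

variable {ι : Type*} (D : SoloServiceData ι)

/-! ### Pen §5 (b')(1),(2): the window of cheap levels -/

/-- Cost ratio (pen §5 (b')(1): "`C_P(n)/C_P(e-1) ≥ n/(e-1)` termwise"): for
`1 ≤ ℓ ≤ n` and `β ≥ 1`, `n C_P(ℓ) ≤ ℓ C_P(n)`. -/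
theorem cost_ratio {c₀ : ℝ} (hW : D ∈ wellFormed c₀) {β : ℝ} (hβ : 1 ≤ β) (P : ι)
    {ℓ n : ℕ} (hℓ1 : 1 ≤ ℓ) (hℓn : ℓ ≤ n) :
    (n : ℝ) * D.cost β P ℓ ≤ (ℓ : ℝ) * D.cost β P n := by
  have hℓpos : (0 : ℝ) < ℓ := by exact_mod_cast hℓ1
  have hnpos : (0 : ℝ) < n := by exact_mod_cast (lt_of_lt_of_le (by omega) hℓn : 0 < n)
  have hℓn' : (ℓ : ℝ) ≤ n := by exact_mod_cast hℓn
  have eℓ : (ℓ : ℝ) ^ β = (ℓ : ℝ) ^ (β - 1) * ℓ := by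
    rw [← Real.rpow_add_one hℓpos.ne', sub_add_cancel]
  have en : (n : ℝ) ^ β = (n : ℝ) ^ (β - 1) * n := by
    rw [← Real.rpow_add_one hnpos.ne', sub_add_cancel]
  have hpow : (ℓ : ℝ) ^ (β - 1) ≤ (n : ℝ) ^ (β - 1) :=
    Real.rpow_le_rpow hℓpos.le hℓn' (by linarith)
  have hg : (0 : ℝ) ≤ D.deg P := by positivity
  have hL : 0 ≤ D.logHt P := hW.2.1 P
  unfold cost
  rw [eℓ, en]
  have hkey : (n : ℝ) * ((ℓ : ℝ) ^ (β - 1) * ℓ) ≤ ℓ * ((n : ℝ) ^ (β - 1) * n) := by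
    have := mul_le_mul_of_nonneg_left hpow (mul_nonneg hnpos.le hℓpos.le)
    nlinarith
  nlinarith [mul_le_mul_of_nonneg_left hkey hg]

/-- Pen §5 (b')(1): a CHEAP server (`m C_P(n) ≤ η n^ν |S|`) obeying the supply bound
`|S| ℓ^ν ≤ T ≤ t C_P(ℓ)` at the level `ℓ = e - 1 ≥ 1` satisfies
`m n ℓ^ν ≤ η t ℓ n^ν`, i.e. `ρ^{ν-1} ≤ η t / m ≤ η t` for `ρ = ℓ / n`:
cheap levels come a bounded factor after the entry (`ρ ≤ ρ_max < 1` once `η t < 1`). -/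
theorem window_upper {c₀ : ℝ} (hW : D ∈ wellFormed c₀) {β : ℝ} (hβ : 1 ≤ β) {P : ι}
    {n ℓ : ℕ} (hℓ1 : 1 ≤ ℓ) (hℓn : ℓ ≤ n) (S : Finset ℕ) {ν η t T : ℝ} (hη : 0 ≤ η)
    (hsupply : (S.card : ℝ) * (ℓ : ℝ) ^ ν ≤ T) (hT : T ≤ t * D.cost β P ℓ)
    (hcheap : (D.mult P n : ℝ) * D.cost β P n ≤ η * (n : ℝ) ^ ν * S.card) :
    (D.mult P n : ℝ) * n * (ℓ : ℝ) ^ ν ≤ η * t * ℓ * (n : ℝ) ^ ν := by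
  have hℓpos : (0 : ℝ) < ℓ := by exact_mod_cast hℓ1
  have hcr := D.cost_ratio hW hβ P hℓ1 hℓn
  have hcostpos : 0 < D.cost β P ℓ := by
    have h1 : (ℓ : ℝ) ^ β ≤ D.cost β P ℓ := D.rpow_le_cost hW β P ℓ
    have h2 : (0 : ℝ) < (ℓ : ℝ) ^ β := Real.rpow_pos_of_pos hℓpos β
    linarith
  have hm : (0 : ℝ) ≤ D.mult P n := by positivity
  have hℓν : (0 : ℝ) ≤ (ℓ : ℝ) ^ ν := (Real.rpow_pos_of_pos hℓpos ν).le
  have hnν : (0 : ℝ) ≤ (n : ℝ) ^ ν := by positivity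
  -- chain: m n ℓ^ν C(ℓ) ≤ m ℓ^ν ℓ C(n) ≤ ℓ ℓ^ν η n^ν |S| ≤ ℓ η n^ν T ≤ ℓ η n^ν t C(ℓ)
  have c1 : (D.mult P n : ℝ) * n * (ℓ : ℝ) ^ ν * D.cost β P ℓ ≤
      (D.mult P n : ℝ) * (ℓ : ℝ) ^ ν * (ℓ * D.cost β P n) := by
    have := mul_le_mul_of_nonneg_left hcr (mul_nonneg hm hℓν)
    nlinarith
  have c2 : (D.mult P n : ℝ) * (ℓ : ℝ) ^ ν * (ℓ * D.cost β P n) ≤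
      (ℓ : ℝ) * (ℓ : ℝ) ^ ν * (η * (n : ℝ) ^ ν * S.card) := by
    have := mul_le_mul_of_nonneg_left hcheap (mul_nonneg hℓpos.le hℓν)
    nlinarith
  have c3 : (ℓ : ℝ) * (ℓ : ℝ) ^ ν * (η * (n : ℝ) ^ ν * S.card) ≤
      (ℓ : ℝ) * (η * (n : ℝ) ^ ν) * T := by
    have := mul_le_mul_of_nonneg_left hsupply
      (mul_nonneg hℓpos.le (mul_nonneg hη hnν))
    nlinarith
  have c4 : (ℓ : ℝ) * (η * (n : ℝ) ^ ν) * T ≤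
      (ℓ : ℝ) * (η * (n : ℝ) ^ ν) * (t * D.cost β P ℓ) :=
    mul_le_mul_of_nonneg_left hT (mul_nonneg hℓpos.le (mul_nonneg hη hnν))
  have c5 : ((D.mult P n : ℝ) * n * (ℓ : ℝ) ^ ν - η * t * ℓ * (n : ℝ) ^ ν) *
      D.cost β P ℓ ≤ 0 := by nlinarith
  by_contra hcon
  push Not at hcon
  have : 0 < ((D.mult P n : ℝ) * n * (ℓ : ℝ) ^ ν - η * t * ℓ * (n : ℝ) ^ ν) *
      D.cost β P ℓ := mul_pos (by linarith) hcostpos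
  linarith

/-- Pen §5 (b')(2): if moreover the server supplies `λ n^ν ≤ m d_P^k` at an assigned column
whose bank is capped, `d_P^k ≤ cap_n(P) ≤ U`, then `λ n ℓ^ν ≤ η t ℓ U`; with
`U ≈ 2 e^{1+β}` (`cap_le_entry`) this is `ρ ≥ ρ_min(e) ≍ c_{e-1} = (e-1)^{ν-1-β}`. -/
theorem window_lower {P : ι} {n ℓ k : ℕ} (hn : 1 ≤ n) {lam ν η t B U : ℝ}
    (hlam : 0 < lam) (hm : (0 : ℝ) < D.mult P n)
    (hsup : lam * (n : ℝ) ^ ν ≤ D.mult P n * D.bank P k) (hcap : D.bank P k ≤ D.cap B P n)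
    (hU : D.cap B P n ≤ U)
    (h1 : (D.mult P n : ℝ) * n * (ℓ : ℝ) ^ ν ≤ η * t * ℓ * (n : ℝ) ^ ν) :
    lam * n * (ℓ : ℝ) ^ ν ≤ η * t * ℓ * U := by
  have hnpos : (0 : ℝ) < n := by exact_mod_cast hn
  have hnν : (0 : ℝ) < (n : ℝ) ^ ν := Real.rpow_pos_of_pos hnpos ν
  have hmU : lam * (n : ℝ) ^ ν ≤ D.mult P n * U :=
    hsup.trans (mul_le_mul_of_nonneg_left (hcap.trans hU) hm.le)
  have hUpos : 0 < U := by
    have hb : 0 < D.mult P n * D.bank P k := lt_of_lt_of_le (mul_pos hlam hnν) hsup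
    have : 0 < D.bank P k := by
      by_contra hneg
      push Not at hneg
      nlinarith
    linarith
  have hℓν : (0 : ℝ) ≤ (ℓ : ℝ) ^ ν := Real.rpow_nonneg (by positivity) ν
  have c1 : lam * (n : ℝ) ^ ν * (n * (ℓ : ℝ) ^ ν) ≤ D.mult P n * U * (n * (ℓ : ℝ) ^ ν) :=
    mul_le_mul_of_nonneg_right hmU (mul_nonneg hnpos.le hℓν)
  have c2 : U * ((D.mult P n : ℝ) * n * (ℓ : ℝ) ^ ν) ≤ U * (η * t * ℓ * (n : ℝ) ^ ν) :=
    mul_le_mul_of_nonneg_left h1 hUpos.le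
  have c3 : (lam * n * (ℓ : ℝ) ^ ν - η * t * ℓ * U) * (n : ℝ) ^ ν ≤ 0 := by nlinarith
  nlinarith

/-! ### Pen §5 Corollary (iii): the payment collected on a window of the life -/

/-- One level of the life: for `1 ≤ ℓ ≤ V` with `P` alive at `ℓ` (so `m_P(ℓ) ≥ 1`),
`m_P(ℓ) C_P(ℓ) / ℓ^{β+2} ≥ g_P / V² + L_P / V^{β+1}` (the summand `m σ_P(ℓ)/ℓ` is
antitone along the window). -/
theorem payment_term {c₀ : ℝ} (hW : D ∈ wellFormed c₀) {β : ℝ} (hβ : 0 ≤ β) {P : ι}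
    {ℓ V : ℕ} (hℓ1 : 1 ≤ ℓ) (hℓV : ℓ ≤ V) (hal : P ∈ D.alive ℓ) :
    (D.deg P : ℝ) / (V : ℝ) ^ 2 + D.logHt P / (V : ℝ) ^ (β + 1) ≤
      (D.mult P ℓ : ℝ) * D.cost β P ℓ / (ℓ : ℝ) ^ (β + 2) := by
  have hℓpos : (0 : ℝ) < ℓ := by exact_mod_cast hℓ1
  have hVpos : (0 : ℝ) < V := by exact_mod_cast (lt_of_lt_of_le (by omega) hℓV : 0 < V)
  have hℓV' : (ℓ : ℝ) ≤ V := by exact_mod_cast hℓV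
  have hg : (0 : ℝ) ≤ D.deg P := by positivity
  have hL : 0 ≤ D.logHt P := hW.2.1 P
  have hm : (1 : ℝ) ≤ D.mult P ℓ := D.one_le_mult_of_alive hW hal
  have hℓβ : (0 : ℝ) < (ℓ : ℝ) ^ β := Real.rpow_pos_of_pos hℓpos β
  have e1 : (ℓ : ℝ) ^ (β + 2) = (ℓ : ℝ) ^ β * (ℓ : ℝ) ^ 2 := by
    rw [Real.rpow_add hℓpos, Real.rpow_two]
  have e2 : (ℓ : ℝ) ^ (β + 1) = (ℓ : ℝ) ^ β * ℓ := by
    rw [Real.rpow_add hℓpos, Real.rpow_one]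
  have e3 : D.cost β P ℓ / (ℓ : ℝ) ^ (β + 2) =
      (D.deg P : ℝ) / (ℓ : ℝ) ^ 2 + D.logHt P / (ℓ : ℝ) ^ (β + 1) := by
    rw [e1, e2]
    unfold cost
    field_simp
  have s1 : (D.deg P : ℝ) / (V : ℝ) ^ 2 ≤ (D.deg P : ℝ) / (ℓ : ℝ) ^ 2 :=
    div_le_div_of_nonneg_left hg (by positivity) (pow_le_pow_left₀ hℓpos.le hℓV' 2)
  have s2 : D.logHt P / (V : ℝ) ^ (β + 1) ≤ D.logHt P / (ℓ : ℝ) ^ (β + 1) :=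
    div_le_div_of_nonneg_left hL (Real.rpow_pos_of_pos hℓpos _)
      (Real.rpow_le_rpow hℓpos.le hℓV' (by linarith))
  have hq : 0 ≤ D.cost β P ℓ / (ℓ : ℝ) ^ (β + 2) := by
    rw [e3]; positivity
  calc (D.deg P : ℝ) / (V : ℝ) ^ 2 + D.logHt P / (V : ℝ) ^ (β + 1)
      ≤ (D.deg P : ℝ) / (ℓ : ℝ) ^ 2 + D.logHt P / (ℓ : ℝ) ^ (β + 1) := add_le_add s1 s2
    _ = 1 * (D.cost β P ℓ / (ℓ : ℝ) ^ (β + 2)) := by rw [e3]; ring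
    _ ≤ (D.mult P ℓ : ℝ) * (D.cost β P ℓ / (ℓ : ℝ) ^ (β + 2)) :=
        mul_le_mul_of_nonneg_right hm hq
    _ = (D.mult P ℓ : ℝ) * D.cost β P ℓ / (ℓ : ℝ) ^ (β + 2) := by ring

/-- Pen §5 Cor (iii) (payment on a window), counting form: if the current life of `P` at
level `n` has entry `e ≥ 1` and `e ≤ V ≤ n`, then
`Σ_{ℓ=e}^{V} m_P(ℓ) C_P(ℓ) / ℓ^{β+2} ≥ (V + 1 - e) (g_P / V² + L_P / V^{β+1})`. -/
theorem payment_lower {c₀ : ℝ} (hW : D ∈ wellFormed c₀) {β : ℝ} (hβ : 0 ≤ β) {P : ι}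
    {n V : ℕ} (he1 : 1 ≤ D.entry P n) (heV : D.entry P n ≤ V) (hVn : V ≤ n) :
    ((V : ℝ) + 1 - D.entry P n) *
        ((D.deg P : ℝ) / (V : ℝ) ^ 2 + D.logHt P / (V : ℝ) ^ (β + 1)) ≤
      ∑ ℓ ∈ Finset.Icc (D.entry P n) V,
        (D.mult P ℓ : ℝ) * D.cost β P ℓ / (ℓ : ℝ) ^ (β + 2) := by
  have hterm : ∀ ℓ ∈ Finset.Icc (D.entry P n) V,
      (D.deg P : ℝ) / (V : ℝ) ^ 2 + D.logHt P / (V : ℝ) ^ (β + 1) ≤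
        (D.mult P ℓ : ℝ) * D.cost β P ℓ / (ℓ : ℝ) ^ (β + 2) := by
    intro ℓ hℓ
    rw [Finset.mem_Icc] at hℓ
    exact D.payment_term hW hβ (he1.trans hℓ.1) hℓ.2
      (D.alive_of_entry_le P n ℓ hℓ.1 (hℓ.2.trans hVn))
  have hsum := Finset.card_nsmul_le_sum (Finset.Icc (D.entry P n) V)
    (fun ℓ => (D.mult P ℓ : ℝ) * D.cost β P ℓ / (ℓ : ℝ) ^ (β + 2)) _ hterm
  have hcard : ((Finset.Icc (D.entry P n) V).card : ℝ) = (V : ℝ) + 1 - D.entry P n := by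
    rw [Nat.card_Icc, Nat.cast_sub (by omega)]
    push_cast
    ring
  rw [nsmul_eq_mul, hcard] at hsum
  exact hsum

end SoloServiceData

/-- Pen §5 Cor (iii), the window constant: for `β ≥ 1`, `g, L ≥ 0`, `0 < e`, `0 < V`,
`θ e ≤ V + 1 - e` and `V ≤ κ e` with `κ ≥ 1`,
`(θ / κ^{β+1}) (g / e + L / e^β) ≤ (V + 1 - e) (g / V² + L / V^{β+1})`
(so the payment on the window is at least `γ'' σ_P(e)` with `γ'' = θ / κ^{β+1}`). -/
theorem soloX_window_payment {β : ℝ} (hβ : 1 ≤ β) {g L e V θ κ : ℝ} (hg : 0 ≤ g)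
    (hL : 0 ≤ L) (he : 0 < e) (hV : 0 < V) (hθ : 0 ≤ θ) (hκ : 1 ≤ κ)
    (hwin : θ * e ≤ V + 1 - e) (hVκ : V ≤ κ * e) :
    θ / κ ^ (β + 1) * (g / e + L / e ^ β) ≤ (V + 1 - e) * (g / V ^ 2 + L / V ^ (β + 1)) := by
  have hκpos : 0 < κ := by linarith
  have hκe : 0 < κ * e := mul_pos hκpos he
  have hX : 0 ≤ g / V ^ 2 + L / V ^ (β + 1) := by positivity
  -- step 1: shrink the length of the window to θ e
  have s1 : θ * e * (g / V ^ 2 + L / V ^ (β + 1)) ≤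
      (V + 1 - e) * (g / V ^ 2 + L / V ^ (β + 1)) := mul_le_mul_of_nonneg_right hwin hX
  -- step 2: replace V by κ e in the denominators
  have s2 : g / (κ * e) ^ 2 ≤ g / V ^ 2 :=
    div_le_div_of_nonneg_left hg (by positivity) (pow_le_pow_left₀ hV.le hVκ 2)
  have s3 : L / (κ * e) ^ (β + 1) ≤ L / V ^ (β + 1) :=
    div_le_div_of_nonneg_left hL (Real.rpow_pos_of_pos hV _)
      (Real.rpow_le_rpow hV.le hVκ (by linarith))
  have s4 : θ * e * (g / (κ * e) ^ 2 + L / (κ * e) ^ (β + 1)) ≤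
      θ * e * (g / V ^ 2 + L / V ^ (β + 1)) :=
    mul_le_mul_of_nonneg_left (add_le_add s2 s3) (mul_nonneg hθ he.le)
  -- step 3: algebra, (κ e)^(β+1) = κ^(β+1) e^β e and κ² ≤ κ^(β+1)
  have e1 : (κ * e) ^ (β + 1) = κ ^ (β + 1) * (e ^ β * e) := by
    rw [Real.mul_rpow hκpos.le he.le, Real.rpow_add he, Real.rpow_one]
  have hκβ : κ ^ 2 ≤ κ ^ (β + 1) := by
    have := Real.rpow_le_rpow_of_exponent_le hκ (by linarith : (2 : ℝ) ≤ β + 1)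
    rwa [Real.rpow_two] at this
  have hκβpos : 0 < κ ^ (β + 1) := Real.rpow_pos_of_pos hκpos _
  have heβpos : 0 < e ^ β := Real.rpow_pos_of_pos he _
  have s5 : θ / κ ^ (β + 1) * (g / e) ≤ θ * e * (g / (κ * e) ^ 2) := by
    rw [mul_pow]
    have : θ * e * (g / (κ ^ 2 * e ^ 2)) = θ / κ ^ 2 * (g / e) := by
      field_simp
    rw [this]
    have hge : 0 ≤ g / e := by positivity
    have : θ / κ ^ (β + 1) ≤ θ / κ ^ 2 :=
      div_le_div_of_nonneg_left hθ (by positivity) hκβ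
    exact mul_le_mul_of_nonneg_right this hge
  have s6 : θ / κ ^ (β + 1) * (L / e ^ β) = θ * e * (L / (κ * e) ^ (β + 1)) := by
    rw [e1]
    field_simp
  calc θ / κ ^ (β + 1) * (g / e + L / e ^ β)
      = θ / κ ^ (β + 1) * (g / e) + θ / κ ^ (β + 1) * (L / e ^ β) := by ring
    _ ≤ θ * e * (g / (κ * e) ^ 2) + θ * e * (L / (κ * e) ^ (β + 1)) := by
        rw [s6]; exact add_le_add s5 le_rfl
    _ = θ * e * (g / (κ * e) ^ 2 + L / (κ * e) ^ (β + 1)) := by ring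
    _ ≤ (V + 1 - e) * (g / V ^ 2 + L / V ^ (β + 1)) := s4.trans s1

end Summit.Schanuel.Schanuel.Theorems
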